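import Literature.Geometry.Lorentzian.ChartCurvature
import Literature.Geometry.Lorentzian.MassCapacityRigidityHarmonic
import HarnessLib

/-!
# A scalar flat metric `ψ⁴ δ` on `ℝ³ ∖ {0}` with two ends is the Schwarzschild metric
# (the last sentence of the proof of the case of equality of Bray's Theorem 9)

Bray, J. Differential Geom. 59 (2001), §6, proof of Thm. 9, case of equality, last paragraph:
*"Since `(M̄³_Σ, ḡ)` has two ends, it must be conformal to `(ℝ³ ∖ {0}, δ)`, and since it has zero
scalar curvature, it follows from equation [`R(u⁴ g₁) = u⁻⁵(−8Δ_{g₁} + R_{g₁}) u`, Appendix A]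
that it must be a Schwarzschild metric."* The two analytic facts in this sentence are in the
tree: the flat case of the conformal transformation law in dimension three,
`OpensChart.scalarCurvature_conformal_fourth_power` (`ChartCurvature.lean`:
`S(ψ⁴ δ) = −8 ψ⁻⁵ Δψ` for a metric with components `ψ⁴ δ` on an open subset of `ℝ³`), and the
classification of two-ended harmonic functions on `ℝ³ ∖ {0}`,
`eq_const_add_div_norm_of_harmonicOnNhd` (`MassCapacityRigidityHarmonic.lean`: `ψ = a + b/|y|`).
This file joins them:

* `OpensChart.harmonicOnNhd_of_scalarCurvature_conformal_eq_zero` — **zero scalar curvature of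
  `ψ⁴ δ` means `Δψ = 0`**: if a metric `g` on an open `U ⊆ ℝ³` has components `ψ⁴ δ` with `ψ`
  of class `C²` and nowhere zero on `U`, and `S(g) = 0` on `U`, then `ψ` is harmonic on `U`
  (Mathlib's `InnerProductSpace.HarmonicOnNhd`, the Laplacian being `∑ᵢ D²ψ(eᵢ, eᵢ)` in the
  standard orthonormal basis);
* `OpensChart.eq_const_add_div_norm_of_scalarCurvature_eq_zero` — **the sentence itself**: if
  moreover `U ⊇ ℝ³ ∖ {0}`, `ψ → a` as `|y| → ∞` and `|y| ψ(y) → b` as `y → 0` (the two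
  asymptotically flat ends), then `ψ(y) = a + b/|y|` for `y ≠ 0`, i.e. `g = (a + b/|y|)⁴ δ` is the
  Schwarzschild metric of mass `2ab` (§1 (12), after the rescaling `z = a² y`; the rescaling and
  the passage to the conclusion of the named fact `Bray2001_capacity_rigidity` are
  `MassCapacityRigidityAssembly.lean`).

Everything is proved; no definitions and no named facts are introduced.

## References

* H. L. Bray, *Proof of the Riemannian Penrose inequality using the positive mass theorem*,
  J. Differential Geom. 59 (2001) 177–267 (arXiv:math/9911173): §6, proof of Thm. 9, last
  paragraph; Appendix A (the scalar curvature of `u⁴ g`); §1 (12). (key `BrayRPI2001`)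
* R. Bartnik, J. Isenberg, *The constraint equations*, in: The Einstein equations and the large
  scale behavior of gravitational fields, Birkhäuser 2004, §4.1 (`R(φ⁴λ) = φ⁻⁵(R(λ)φ − 8Δ_λ φ)`).
  (key `BartnikIsenberg2004`)
-/

noncomputable section

open Set Filter Metric Topology Bornology InnerProductSpace TopologicalSpace Manifold
open scoped Real Laplacian Manifold ContDiff

namespace Literature.Geometry.Lorentzian

namespace OpensChart

open Literature.Analysis.PDE

-- instance search through the nested operator type `E3 →L[ℝ] E3 →L[ℝ] ℝ` of the components
set_option maxSynthPendingDepth 3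

variable {U : Opens E3} {n : ℕ∞ω} [Fact (1 ≤ n)]
  {g : PseudoRiemannianMetric 𝓘(ℝ, E3) n E3 (TangentSpace 𝓘(ℝ, E3) : U → Type _)}

/-- **Zero scalar curvature of `ψ⁴ δ` means that `ψ` is harmonic.** Let `g` be a metric on an
open `U ⊆ ℝ³` (of class `C^n`, `n ≥ 2`, with a Levi-Civita connection) whose components are
`ψ⁴ δ` for a function `ψ` of class `C²` and nowhere zero on `U`. If the scalar curvature of `g`
vanishes on `U`, then `ψ` is harmonic on `U`: by `scalarCurvature_conformal_fourth_power`,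
`0 = S(g)(x) = −8 ψ(x)⁻⁵ ∑ᵢ D²ψ(x)(eᵢ, eᵢ) = −8 ψ(x)⁻⁵ Δψ(x)`. Bray 2001, Appendix A ("it
follows from equation … that"); Bartnik–Isenberg 2004, §4.1. [cite: BrayRPI2001, §6 Thm. 9,
proof of the case of equality (last paragraph), with Appendix A] -/
theorem harmonicOnNhd_of_scalarCurvature_conformal_eq_zero [g.HasLeviCivita] (hn : 2 ≤ n)
    {ψ : E3 → ℝ}
    (hG : ∀ y : U, g.val y = ψ y ^ 4 • (innerSL ℝ (E := E3) : E3 →L[ℝ] E3 →L[ℝ] ℝ))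
    (hψ0 : ∀ y : U, ψ y ≠ 0) (hψ : ContDiffOn ℝ 2 ψ (U : Set E3))
    (hR : ∀ x : U, g.scalarCurvature x = 0) :
    HarmonicOnNhd ψ (U : Set E3) := by
  set e := EuclideanSpace.basisFun (Fin 3) ℝ with he
  have hd : ∀ y : U, DifferentiableAt ℝ ψ y := fun y ↦
    (hψ.contDiffAt (U.isOpen.mem_nhds y.2)).differentiableAt two_ne_zero
  -- `Δψ = 0` at every point of `U`
  have hΔ : ∀ z ∈ (U : Set E3), Δ ψ z = 0 := by
    intro z hz
    have h2 : ContDiffAt ℝ 2 ψ z := hψ.contDiffAt (U.isOpen.mem_nhds hz)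
    have hF' : HasFDerivAt (fderiv ℝ ψ) (fderiv ℝ (fderiv ℝ ψ) z) z :=
      ((h2.fderiv_right (m := 1) le_rfl).differentiableAt one_ne_zero).hasFDerivAt
    have key := scalarCurvature_conformal_fourth_power (g := g)
      (G := fun y ↦ ψ y ^ 4 • (innerSL ℝ (E := E3) : E3 →L[ℝ] E3 →L[ℝ] ℝ))
      (δ := (innerSL ℝ (E := E3) : E3 →L[ℝ] E3 →L[ℝ] ℝ)) (fun _ _ ↦ rfl) hG hn (fun _ ↦ rfl)
      e ⟨z, hz⟩ hψ0 hd hF'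
    rw [hR ⟨z, hz⟩] at key
    have h8 : (-8 * (ψ z ^ 5)⁻¹ : ℝ) ≠ 0 := by
      have := hψ0 ⟨z, hz⟩
      exact mul_ne_zero (by norm_num) (inv_ne_zero (pow_ne_zero 5 this))
    have hsum : ∑ i, fderiv ℝ (fderiv ℝ ψ) z (e i) (e i) = 0 :=
      (mul_eq_zero.1 key.symm).resolve_left h8
    rw [laplacian_eq_sum_of_contDiffAt e h2, ← hsum]
    refine Finset.sum_congr rfl fun i _ ↦ ?_
    rw [fderiv_fderiv_apply_eq_fderiv_fderiv h2]
  intro x hx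
  refine ⟨hψ.contDiffAt (U.isOpen.mem_nhds hx), ?_⟩
  filter_upwards [U.isOpen.mem_nhds hx] with z hz
  exact hΔ z hz

/-- **A scalar flat `ψ⁴ δ` on `ℝ³ ∖ {0}` with two ends is Schwarzschild** (the last sentence of
the proof of the case of equality of Bray's Theorem 9). Let `g` be a metric of class `C^n`,
`n ≥ 2`, on an open `U ⊇ ℝ³ ∖ {0}` with components `ψ⁴ δ`, `ψ` of class `C²` and nowhere zero on
`U`, and with zero scalar curvature. If `ψ(y) → a` as `|y| → ∞` and `|y| ψ(y) → b` as `y → 0`,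
`y ≠ 0` — the behaviour of the conformal factor at the two asymptotically flat ends, the one at
infinity and the one at the origin (read in the inverted chart; cf.
`tendsto_norm_mul_of_tendsto_inversion`, `MassCapacityRigidityAssembly.lean`) — then
`ψ(y) = a + b/|y|` for all `y ≠ 0`: `g = (a + b/|y|)⁴ δ`, the Schwarzschild metric of mass `2ab`
(§1 (12) after `z = a² y`). Proof: `ψ` is harmonic on `ℝ³ ∖ {0}`
(`harmonicOnNhd_of_scalarCurvature_conformal_eq_zero`) and two-ended harmonic functions are
`a + b/|y|` (`eq_const_add_div_norm_of_harmonicOnNhd`). [cite: BrayRPI2001, §6 Thm. 9, proof of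
the case of equality (last paragraph), with Appendix A and §1 (12)] -/
theorem eq_const_add_div_norm_of_scalarCurvature_eq_zero [g.HasLeviCivita] (hn : 2 ≤ n)
    (hU : ∀ y : E3, y ≠ 0 → y ∈ U) {ψ : E3 → ℝ}
    (hG : ∀ y : U, g.val y = ψ y ^ 4 • (innerSL ℝ (E := E3) : E3 →L[ℝ] E3 →L[ℝ] ℝ))
    (hψ0 : ∀ y : U, ψ y ≠ 0) (hψ : ContDiffOn ℝ 2 ψ (U : Set E3))
    (hR : ∀ x : U, g.scalarCurvature x = 0) {a b : ℝ}
    (hinf : Tendsto ψ (cobounded E3) (𝓝 a))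
    (hzero : Tendsto (fun y ↦ ‖y‖ * ψ y) (𝓝[≠] 0) (𝓝 b)) :
    ∀ y : E3, y ≠ 0 → ψ y = a + b / ‖y‖ :=
  eq_const_add_div_norm_of_harmonicOnNhd
    ((harmonicOnNhd_of_scalarCurvature_conformal_eq_zero hn hG hψ0 hψ hR).mono
      fun y hy ↦ hU y hy) hinf hzero

end OpensChart

end Literature.Geometry.Lorentzian

end
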